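import Literature.MathematicalPhysics.QuantumFieldTheory.Balaban1983to89.B2Prop31ZeroFieldConcrete

/-!
# `Balaban1983to89.B2Ineq329ZeroFieldConcreteFamily` — [Balaban1982Higgs2] (3.29) p. 590: the cell's VERBATIM-TYPED
`B2.Ineq329Printed κ₀` INHABITED by the ZERO-FIELD INSTANCES OF THE CONCRETE CARRIER — `form` = the k-th form of (3.28),
`B2Eq328ConcretePieces.termForm R C a 0 m² j ψ` = ⟨φ′_k, Δ⁽ᵏ⁾(Bᵏ(Λ_k), 0)φ′_k⟩, the two sums of (3.29) the printed ones — for EVERY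
`κ₀`, with `γ₀ = min(a(1 − L⁻²)/(8d + 2m²), 1/4)` and error constant `C = 0`, by `B2Prop31ZeroFieldConcrete.ineq329_zero_concrete`

statement-level skeleton of published theorems with citation tags; proofs where landed; nothing here is a claim about the Yang–Mills mass gap

CITATION HEADER.  T. Bałaban, *(Higgs)₂,₃ quantum fields in a finite volume. II. An upper bound*, Commun. Math. Phys. **86**
(1982) 555–594 [Balaban1982Higgs2], (3.29) p. 590 (PDF held `paper:balaban1982-cmp86-higgs23-ii`; p. 590 [PDF 36] READ AS IMAGE on
the ×2 render `run/shared/lean/pub/pub-balaban/b2b-balaban-ref1/pages/1982-cmp86-higgs23-II/1982-cmp86-higgs23-II-p036-x2.png`).  Unit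
`lit-balaban-p15` gen 4, target 3, file 4 (Phase-2 proof seat p15; HOME `run/shared/lean/pub/lit-balaban/`).  SKELETON row **B2.Eq3.29**
(decl of record `B2.Ineq329Printed`, cell pub-balaban unit pv07; owner r02).  The ℤ^{d+1}-carrier twin is r14's
`B2Prop31ZeroField.ineq329Printed_zeroField`.

WHAT IS PRINTED (p. 590): *"⟨φ′_k, Δ⁽ᵏ⁾(Bᵏ(Λ_k), Ã^η)φ′_k⟩ ≥ γ₀(Σ_{⟨x,x′⟩⊂Λ_k}|U(Ã^η(⟨x,x′⟩))φ′_k(x′) − φ′_k(x)|² + Σ_{x∈Λ_k}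
m²(Lᵏε)²|φ′_k(x)|²) − O((Lᵏε)^{κ₀})|Λ_k|, (3.29) with a constant γ₀ independent of k, Λ_k and for φ′_k, Ã^η satisfying suitable
restrictions."*

DICTIONARY (`Ã = 0`, `U ≡ 1`; `s = Lᵏε`; the rescaling sentence p. 590 `φ_k(x) = (Lᵏε)^{−(d−2)/2}φ′_k((Lᵏε)⁻¹x)`): for `ψ = φ_k`
on `Λ_k ⊂ T⁽ᵏ⁾`, `covDiffSq` = `Σ_{⟨x,x′⟩⊂Λ_k}|φ′_k(x′) − φ′_k(x)|²` = `Σ_{⟨y,y′⟩⊂Λ_k}s^{d−2}|ψ(y′) − ψ(y)|²` = `bondK R j ψ`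
(`B2.rescale_bond`); `l2sq` = `Σ_{x∈Λ_k}|φ′_k(x)|²` = `s^{d−2}Σ_{y∈Λ_k}|ψ(y)|²` = `s⁻²·Σ_{y}s^d|ψ(y)|²`, so that `m²s²·l2sq = massK R m² j ψ`
(`B2.rescale_mass`); `form` = `⟨φ′_k, Δ⁽ᵏ⁾(Bᵏ(Λ_k), 0)φ′_k⟩` = `⟨φ_k, Δ^{(k),Lᵏε}(Bᵏ(Λ_k), 0)φ_k⟩` = `termForm R C a 0 m² j ψ` (the
k-th term of (3.28)); `vol = |Λ_k|`; `restricted := True` (no restriction is used at zero field).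

WHAT THIS MODULE PROVES (kernel-checked, 0 `sorry`, standard axioms): `ZI329Idx`, `concreteZero329Fam`, `massTerm_eq_massK`,
**`ineq329Printed_concreteZeroField`**: `B2.Ineq329Printed κ₀ (concreteZero329Fam C a m²)` for every `κ₀`, `a > 0`, `L > 1`, `m² ≥ 0`.
HONEST SCOPE.  Zero vector field only; nothing for `Ã ≠ 0` (B4's Prop. 3.1′, cell GAPS G-pv07-1).
-/

noncomputable section

open MeasureTheory Finset Real
open scoped BigOperators ENNReal InnerProductSpace

namespace Literature.MathematicalPhysics.QuantumFieldTheory.Balaban1983to89.B2Ineq329ZeroFieldConcreteFamily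

open Literature.MathematicalPhysics.QuantumFieldTheory.Balaban1983to89.HiggsLattice
open Literature.MathematicalPhysics.QuantumFieldTheory.Balaban1983to89.HiggsAveraging
open Literature.MathematicalPhysics.QuantumFieldTheory.Balaban1983to89.HiggsCovariance
open Literature.MathematicalPhysics.QuantumFieldTheory.Balaban1983to89.B2Eq337ScalarIntegration
open Literature.MathematicalPhysics.QuantumFieldTheory.Balaban1983to89.B2Eq325ConcreteSchur
open Literature.MathematicalPhysics.QuantumFieldTheory.Balaban1983to89.B2Eq328ConcretePieces
open Literature.MathematicalPhysics.QuantumFieldTheory.Balaban1983to89.B2Prop31ZeroFieldConcrete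

variable {P : HiggsLattice.Params} {N : ℕ}

/-- Index of ONE zero-field instance of (3.29) on the concrete carrier: the number of scales `K` (`≤` that of the lattice family,
stopping rule `Lᴷε ≤ 1`), region data `R`, a scale `k = j + 1 ≤ K` and a field `ψ = φ_k : Λ_k → ℝ^N`.
[cite: Balaban1982Higgs2, (3.29) p.590] -/
structure ZI329Idx (P : HiggsLattice.Params) (N : ℕ) where
  /-- the number of renormalization steps -/
  K : ℕ
  /-- `K ≤` the number of scales of the lattice family -/
  hK : K ≤ P.K
  /-- the stopping rule `Lᴷε ≤ 1` -/
  hε : P.mesh K ≤ 1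
  /-- the region data -/
  R : Regions P K
  /-- the scale `k = j + 1` -/
  j : Fin K
  /-- the field `φ_k` on `Λ_k` -/
  ψ : LSite R j → V N

/-- **The zero-field instances of `B2.I329Setting` on the concrete carrier** (dictionary in the module header).
[cite: Balaban1982Higgs2, (3.29) p.590] -/
def concreteZero329Fam (C : ChargeData N) (a msq : ℝ) (i : ZI329Idx P N) : B2.I329Setting where
  s := P.mesh (i.j.val + 1)
  massSq := msq
  restricted := True
  form := termForm i.R C a (0 : HiggsLattice.VecField P 0) msq i.j i.ψ
  covDiffSq := bondK i.R i.j i.ψ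
  l2sq := (P.mesh (i.j.val + 1))⁻¹ ^ 2 * ∑ y : LSite i.R i.j, P.mesh (i.j.val + 1) ^ P.d * ‖i.ψ y‖ ^ 2
  vol := (i.R.block i.j).card

/-- `m²s²·l2sq = massK` (the rescaling `B2.rescale_mass` in the `Lᵏε`-lattice variables). [cite: Balaban1982Higgs2, (3.29) p.590] -/
theorem massTerm_eq_massK (C : ChargeData N) (a msq : ℝ) (i : ZI329Idx P N) :
    (concreteZero329Fam C a msq i).massSq * (concreteZero329Fam C a msq i).s ^ 2 * (concreteZero329Fam C a msq i).l2sq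
      = massK i.R msq i.j i.ψ := by
  dsimp only [concreteZero329Fam]
  have hs : P.mesh (i.j.val + 1) ≠ 0 := (P.mesh_pos _).ne'
  have h1 : msq * P.mesh (i.j.val + 1) ^ 2 * ((P.mesh (i.j.val + 1))⁻¹ ^ 2
      * ∑ y : LSite i.R i.j, P.mesh (i.j.val + 1) ^ P.d * ‖i.ψ y‖ ^ 2)
      = msq * ∑ y : LSite i.R i.j, P.mesh (i.j.val + 1) ^ P.d * ‖i.ψ y‖ ^ 2 := by
    field_simp
  rw [h1, massK, Finset.mul_sum]
  exact Finset.sum_congr rfl fun y _ => by ring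

/-- **THE CELL'S TYPED (3.29) `B2.Ineq329Printed κ₀` HOLDS ON THE ZERO-FIELD INSTANCES OF THE CONCRETE CARRIER**, for every `κ₀`,
with `γ₀ = min(a(1 − L⁻²)/(8d + 2m²), 1/4)` and `C = 0` (`a > 0`, `L > 1`, `m² ≥ 0`). [cite: Balaban1982Higgs2, (3.29) p.590] -/
theorem ineq329Printed_concreteZeroField (κ₀ : ℝ) (C : ChargeData N) {a msq : ℝ} (ha : 0 < a) (hL : 1 < P.L)
    (hmsq : 0 ≤ msq) : B2.Ineq329Printed κ₀ (concreteZero329Fam (P := P) C a msq) := by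
  refine ⟨gamma0 P a msq, 0, gamma0_pos ha hL hmsq, le_rfl, fun i _ => ?_⟩
  have h := ineq329_zero_concrete i.R C ha hL hmsq i.hK i.j ((mesh_le_mesh (Nat.succ_le_of_lt i.j.isLt)).trans i.hε) i.ψ
  rw [zero_mul, zero_mul, sub_zero, massTerm_eq_massK]
  exact h

end Literature.MathematicalPhysics.QuantumFieldTheory.Balaban1983to89.B2Ineq329ZeroFieldConcreteFamily
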